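import Summits.QuantumFields.BalabanUV.Beta.GAN24.CapacitanceClosedForm
import Summits.QuantumFields.BalabanUV.Beta.GAN24.Capacitance

/-!
# `BalabanUV.Beta.GAN24.CapacitanceClosedFormMatrix` — binder row G-an2-4 / (CONV-C), road P1-fibre, crux A4 of `SKELETON-P1.md` (typer row P1-Y08f, part 3):
# the closed-form inverse of the capacitance matrix AS A MATRIX — `(capMat F)⁻¹ = invMat`, `IsUnit (capMat F)` without any determinant

NOT IN PRINT; OUR PROOF ATTEMPT.  HONEST FRAMING (cell contract, verbatim): «discharging `BetaPertH` makes Bałaban's UV stability UNCONDITIONAL — a real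
constructive-QFT result; it is NOT the continuum limit and NOT the Clay problem.»  HONEST DEPENDENCY (verbatim): «continuum YM on T⁴ ⇐ BetaPertH ∧ nine spine
estimates (0/9 proved); BetaPertH ⇐ (D1) ∧ (D4) ∧ CAP+tail; G-an2-4 gates asym, D1 and NE2/3/4.»  [folklore] finite-dimensional linear algebra over `ℂ` (no estimate
beyond the triangle inequality, no cited fact, no wall binder, no `def … : Prop` hypothesis).  NOT summit progress; nothing of (CONV-C)'s K-slot is discharged here.

## What is proved
`GAN24/CapacitanceClosedForm` (p201156) solves the capacitance system of `CapacitanceSolve` in closed form under the telescoping identities (T1)/(T2);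
`GAN24/Capacitance` (leaf P1-L05 (b), p201346) packages the same system as the matrix `capMat F : Matrix (Fin D ⊕ Unit) (Fin D ⊕ Unit) ℂ` with
`capSolves_iff_mulVec` and `isUnit_capMat_of_injective`.  THIS FILE glues the two:
* `invMat a δ δ' σ` — the explicit block matrix `[[invPP, invPc],[invcP, invcc]]` of `CapacitanceClosedForm` §5, and `invMat_mulVec`:
  `invMat *ᵥ (Q; R) = (phiCF; cCF)`;
* for `F : CapacitanceSolve.Fibre D ι` under (T1)/(T2) and `aDiag F κ ≠ 0`, `sigma F ≠ 0`, `hSum (aDiag F) δ δ' ≠ 0`: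
  **`isUnit_capMat`** (`Capacitance.isUnit_capMat_of_injective` ∘ `CapacitanceClosedForm.cap_injective` — no determinant of the Bloch fibre matrix is used),
  `capMat_mulVec_invMat_mulVec` (`capMat F *ᵥ (invMat *ᵥ y) = y`), **`capMat_mul_invMat`** (`capMat F * invMat = 1`), `invMat_mul_capMat`,
  **`inv_capMat_eq`** (`(capMat F)⁻¹ = invMat (aDiag F) δ δ' (sigma F)`), the four entry formulas `inv_capMat_inl_inl` … `inv_capMat_inr_inr`, and the
  NO-CANCELLATION entry bounds of `(capMat F)⁻¹` (`norm_inv_capMat_inl_inl_le` ≤ α + α²ε²η, `…_inl_inr_le`/`…_inr_inl_le` ≤ αεςη, `…_inr_inr_le` ≤ ς/2 + ς²η)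
  from `‖(aDiag F κ)⁻¹‖ ≤ α`, `‖δ κ‖, ‖δ' κ‖ ≤ ε`, `‖(sigma F)⁻¹‖ ≤ ς`, `‖(hSum …)⁻¹‖ ≤ η` — the currency in which leaf P1-L08 (`cap_lower`) and Part B (L11)
  consume the crux once the scalar bounds (typer row P1-Y08s) supply `α ~ |p|²/N^{D+4}`, `ς ~ |p|⁴/N^{D+4}`, `η ~ N^{D+4}/|p|⁴`, `ε ~ |p|` at real `p`.
-/

open Finset
open scoped BigOperators

namespace Summit.QuantumFields.BalabanUV.Beta.GAN24.CapacitanceClosedFormMatrix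

open FibreBlockSolve (dot)
open CapacitanceSolve (Fibre capP capV capW CapSolves)
open CapacitanceClosedForm (hSum uCF cCF phiCF aDiag sigma invPP invPc invcP invcc)
open Capacitance (capMat capVec)

variable {D : ℕ} {ι : Type*}

/-! ## §1 The explicit inverse as a block matrix -/

/-- [folklore] THE EXPLICIT INVERSE MATRIX `[[invPP, invPc],[invcP, invcc]]` on `Fin D ⊕ Unit`. -/
noncomputable def invMat (a δ δ' : Fin D → ℂ) (σ : ℂ) : Matrix (Fin D ⊕ Unit) (Fin D ⊕ Unit) ℂ :=
  Matrix.fromBlocks (Matrix.of fun κ l => invPP a δ δ' κ l) (Matrix.of fun κ _ => invPc a δ δ' σ κ)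
    (Matrix.of fun _ l => invcP a δ δ' σ l) (Matrix.of fun _ _ => invcc a δ δ' σ)

/-- [folklore] Entries of `invMat`: `φφ` block. -/
@[simp] theorem invMat_inl_inl (a δ δ' : Fin D → ℂ) (σ : ℂ) (κ l : Fin D) :
    invMat a δ δ' σ (Sum.inl κ) (Sum.inl l) = invPP a δ δ' κ l := rfl

/-- [folklore] Entries of `invMat`: `φc` column. -/
@[simp] theorem invMat_inl_inr (a δ δ' : Fin D → ℂ) (σ : ℂ) (κ : Fin D) (u : Unit) :
    invMat a δ δ' σ (Sum.inl κ) (Sum.inr u) = invPc a δ δ' σ κ := rfl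

/-- [folklore] Entries of `invMat`: `cφ` row. -/
@[simp] theorem invMat_inr_inl (a δ δ' : Fin D → ℂ) (σ : ℂ) (u : Unit) (l : Fin D) :
    invMat a δ δ' σ (Sum.inr u) (Sum.inl l) = invcP a δ δ' σ l := rfl

/-- [folklore] Entries of `invMat`: `cc` corner. -/
@[simp] theorem invMat_inr_inr (a δ δ' : Fin D → ℂ) (σ : ℂ) (u u' : Unit) :
    invMat a δ δ' σ (Sum.inr u) (Sum.inr u') = invcc a δ δ' σ := rfl

/-- [folklore] **`invMat *ᵥ (Q; R) = (phiCF; cCF)`** — the matrix acts as the closed-form solution (`phiCF_eq_blocks`, `cCF_eq_blocks`). -/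
theorem invMat_mulVec (a δ δ' : Fin D → ℂ) (σ : ℂ) (Q : Fin D → ℂ) (R : ℂ) :
    (invMat a δ δ' σ).mulVec (Sum.elim Q (fun _ => R)) = Sum.elim (phiCF a δ δ' σ Q R) (fun _ => cCF a δ δ' σ Q R) := by
  unfold invMat
  rw [Matrix.fromBlocks_mulVec]
  congr 1
  · funext κ
    rw [CapacitanceClosedForm.phiCF_eq_blocks]
    simp [Matrix.mulVec, dotProduct]
  · funext u
    rw [CapacitanceClosedForm.cCF_eq_blocks]
    simp [Matrix.mulVec, dotProduct]

/-! ## §2 `capMat F` times the explicit inverse -/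

section Fibre

variable [Fintype ι] (F : Fibre D ι)

/-- [folklore] **INVERTIBILITY WITHOUT A DETERMINANT**: under (T1)/(T2) and the three non-vanishings, `capMat F` is a unit
(`Capacitance.isUnit_capMat_of_injective` fed by `CapacitanceClosedForm.cap_injective`). -/
theorem isUnit_capMat (δ δ' : Fin D → ℂ) (hT1 : ∀ m κ, F.wQ m κ * F.dd m κ = F.wM m * δ κ)
    (hT2 : ∀ m κ, F.db m κ * F.wE m κ = F.wG m * δ' κ) (ha : ∀ κ, aDiag F κ ≠ 0) (hσ : sigma F ≠ 0)
    (hh : hSum (aDiag F) δ δ' ≠ 0) : IsUnit (capMat F) :=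
  Capacitance.isUnit_capMat_of_injective F (CapacitanceClosedForm.cap_injective F δ δ' hT1 hT2 ha hσ hh)

/-- [folklore] `capMat F *ᵥ (φ; c)` in the structured (bordered diagonal) form under (T1)/(T2). -/
theorem capMat_mulVec_elim (δ δ' : Fin D → ℂ) (hT1 : ∀ m κ, F.wQ m κ * F.dd m κ = F.wM m * δ κ)
    (hT2 : ∀ m κ, F.db m κ * F.wE m κ = F.wG m * δ' κ) (φ : Fin D → ℂ) (c : ℂ) :
    (capMat F).mulVec (Sum.elim φ (fun _ => c))
      = Sum.elim (fun κ => aDiag F κ * φ κ - sigma F / 2 * δ κ * dot δ' φ + sigma F * δ κ * c) (fun _ => sigma F * dot δ' φ) := by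
  have h := Capacitance.capMat_mulVec_capVec F φ c
  unfold capVec at h
  rw [h]
  congr 1
  · funext κ
    rw [CapacitanceClosedForm.sum_capP_mul F δ δ' hT1 hT2, CapacitanceClosedForm.capV_eq F δ hT1]
  · funext u
    rw [CapacitanceClosedForm.sum_capW_mul F δ' hT2]

/-- [folklore] **RIGHT INVERSE ON VECTORS**: `capMat F *ᵥ (invMat *ᵥ y) = y` for every `y`. -/
theorem capMat_mulVec_invMat_mulVec (δ δ' : Fin D → ℂ) (hT1 : ∀ m κ, F.wQ m κ * F.dd m κ = F.wM m * δ κ)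
    (hT2 : ∀ m κ, F.db m κ * F.wE m κ = F.wG m * δ' κ) (ha : ∀ κ, aDiag F κ ≠ 0) (hσ : sigma F ≠ 0)
    (hh : hSum (aDiag F) δ δ' ≠ 0) (y : Fin D ⊕ Unit → ℂ) :
    (capMat F).mulVec ((invMat (aDiag F) δ δ' (sigma F)).mulVec y) = y := by
  have hy : y = Sum.elim (fun κ => y (Sum.inl κ)) (fun _ => y (Sum.inr ())) := by
    funext i; rcases i with κ | ⟨⟩ <;> rfl
  rw [hy, invMat_mulVec, capMat_mulVec_elim F δ δ' hT1 hT2]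
  obtain ⟨hrow, hc⟩ := (CapacitanceClosedForm.bordered_iff_closedForm (aDiag F) δ δ' (sigma F) (fun κ => y (Sum.inl κ))
    (y (Sum.inr ())) ha hσ hh _ _).2 ⟨rfl, rfl⟩
  congr 1
  · funext κ; exact hrow κ
  · funext u; exact hc

/-- [folklore] **`capMat F * invMat = 1`.** -/
theorem capMat_mul_invMat (δ δ' : Fin D → ℂ) (hT1 : ∀ m κ, F.wQ m κ * F.dd m κ = F.wM m * δ κ)
    (hT2 : ∀ m κ, F.db m κ * F.wE m κ = F.wG m * δ' κ) (ha : ∀ κ, aDiag F κ ≠ 0) (hσ : sigma F ≠ 0)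
    (hh : hSum (aDiag F) δ δ' ≠ 0) : capMat F * invMat (aDiag F) δ δ' (sigma F) = 1 := by
  apply Matrix.toLin'.injective
  apply LinearMap.ext
  intro y
  rw [Matrix.toLin'_apply, Matrix.toLin'_apply, Matrix.one_mulVec, ← Matrix.mulVec_mulVec]
  exact capMat_mulVec_invMat_mulVec F δ δ' hT1 hT2 ha hσ hh y

/-- [folklore] **`invMat * capMat F = 1`** (square matrices: a right inverse is a left inverse). -/
theorem invMat_mul_capMat (δ δ' : Fin D → ℂ) (hT1 : ∀ m κ, F.wQ m κ * F.dd m κ = F.wM m * δ κ)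
    (hT2 : ∀ m κ, F.db m κ * F.wE m κ = F.wG m * δ' κ) (ha : ∀ κ, aDiag F κ ≠ 0) (hσ : sigma F ≠ 0)
    (hh : hSum (aDiag F) δ δ' ≠ 0) : invMat (aDiag F) δ δ' (sigma F) * capMat F = 1 :=
  mul_eq_one_comm.mp (capMat_mul_invMat F δ δ' hT1 hT2 ha hσ hh)

/-- [folklore] **THE INVERSE MATRIX, EXPLICITLY**: `(capMat F)⁻¹ = invMat (aDiag F) δ δ' (sigma F)`. -/
theorem inv_capMat_eq (δ δ' : Fin D → ℂ) (hT1 : ∀ m κ, F.wQ m κ * F.dd m κ = F.wM m * δ κ)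
    (hT2 : ∀ m κ, F.db m κ * F.wE m κ = F.wG m * δ' κ) (ha : ∀ κ, aDiag F κ ≠ 0) (hσ : sigma F ≠ 0)
    (hh : hSum (aDiag F) δ δ' ≠ 0) : (capMat F)⁻¹ = invMat (aDiag F) δ δ' (sigma F) :=
  Matrix.inv_eq_right_inv (capMat_mul_invMat F δ δ' hT1 hT2 ha hσ hh)

/-! ## §3 Entries and no-cancellation bounds of `(capMat F)⁻¹` -/

/-- [folklore] `(capMat F)⁻¹ (inl κ) (inl l) = invPP`. -/
theorem inv_capMat_inl_inl (δ δ' : Fin D → ℂ) (hT1 : ∀ m κ, F.wQ m κ * F.dd m κ = F.wM m * δ κ)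
    (hT2 : ∀ m κ, F.db m κ * F.wE m κ = F.wG m * δ' κ) (ha : ∀ κ, aDiag F κ ≠ 0) (hσ : sigma F ≠ 0)
    (hh : hSum (aDiag F) δ δ' ≠ 0) (κ l : Fin D) :
    (capMat F)⁻¹ (Sum.inl κ) (Sum.inl l) = invPP (aDiag F) δ δ' κ l := by
  rw [inv_capMat_eq F δ δ' hT1 hT2 ha hσ hh, invMat_inl_inl]

/-- [folklore] `(capMat F)⁻¹ (inl κ) (inr _) = invPc`. -/
theorem inv_capMat_inl_inr (δ δ' : Fin D → ℂ) (hT1 : ∀ m κ, F.wQ m κ * F.dd m κ = F.wM m * δ κ)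
    (hT2 : ∀ m κ, F.db m κ * F.wE m κ = F.wG m * δ' κ) (ha : ∀ κ, aDiag F κ ≠ 0) (hσ : sigma F ≠ 0)
    (hh : hSum (aDiag F) δ δ' ≠ 0) (κ : Fin D) (u : Unit) :
    (capMat F)⁻¹ (Sum.inl κ) (Sum.inr u) = invPc (aDiag F) δ δ' (sigma F) κ := by
  rw [inv_capMat_eq F δ δ' hT1 hT2 ha hσ hh, invMat_inl_inr]

/-- [folklore] `(capMat F)⁻¹ (inr _) (inl l) = invcP`. -/
theorem inv_capMat_inr_inl (δ δ' : Fin D → ℂ) (hT1 : ∀ m κ, F.wQ m κ * F.dd m κ = F.wM m * δ κ)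
    (hT2 : ∀ m κ, F.db m κ * F.wE m κ = F.wG m * δ' κ) (ha : ∀ κ, aDiag F κ ≠ 0) (hσ : sigma F ≠ 0)
    (hh : hSum (aDiag F) δ δ' ≠ 0) (u : Unit) (l : Fin D) :
    (capMat F)⁻¹ (Sum.inr u) (Sum.inl l) = invcP (aDiag F) δ δ' (sigma F) l := by
  rw [inv_capMat_eq F δ δ' hT1 hT2 ha hσ hh, invMat_inr_inl]

/-- [folklore] `(capMat F)⁻¹ (inr _) (inr _) = invcc`. -/
theorem inv_capMat_inr_inr (δ δ' : Fin D → ℂ) (hT1 : ∀ m κ, F.wQ m κ * F.dd m κ = F.wM m * δ κ)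
    (hT2 : ∀ m κ, F.db m κ * F.wE m κ = F.wG m * δ' κ) (ha : ∀ κ, aDiag F κ ≠ 0) (hσ : sigma F ≠ 0)
    (hh : hSum (aDiag F) δ δ' ≠ 0) (u u' : Unit) :
    (capMat F)⁻¹ (Sum.inr u) (Sum.inr u') = invcc (aDiag F) δ δ' (sigma F) := by
  rw [inv_capMat_eq F δ δ' hT1 hT2 ha hσ hh, invMat_inr_inr]

/-- [folklore] **`φφ` BLOCK BOUND**: `‖(capMat F)⁻¹ (inl κ) (inl l)‖ ≤ α + α²ε²η`. -/
theorem norm_inv_capMat_inl_inl_le (δ δ' : Fin D → ℂ) (hT1 : ∀ m κ, F.wQ m κ * F.dd m κ = F.wM m * δ κ)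
    (hT2 : ∀ m κ, F.db m κ * F.wE m κ = F.wG m * δ' κ) (ha : ∀ κ, aDiag F κ ≠ 0) (hσ : sigma F ≠ 0)
    (hh : hSum (aDiag F) δ δ' ≠ 0) {α ε η : ℝ} (hα : ∀ κ, ‖(aDiag F κ)⁻¹‖ ≤ α) (hε : ∀ κ, ‖δ κ‖ ≤ ε)
    (hε' : ∀ κ, ‖δ' κ‖ ≤ ε) (hη : ‖(hSum (aDiag F) δ δ')⁻¹‖ ≤ η) (κ l : Fin D) :
    ‖(capMat F)⁻¹ (Sum.inl κ) (Sum.inl l)‖ ≤ α + α ^ 2 * ε ^ 2 * η := by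
  rw [inv_capMat_inl_inl F δ δ' hT1 hT2 ha hσ hh]
  exact CapacitanceClosedForm.norm_invPP_le (aDiag F) δ δ' hα hε hε' hη κ l

/-- [folklore] **`φc` COLUMN BOUND**: `‖(capMat F)⁻¹ (inl κ) (inr _)‖ ≤ αεςη`. -/
theorem norm_inv_capMat_inl_inr_le (δ δ' : Fin D → ℂ) (hT1 : ∀ m κ, F.wQ m κ * F.dd m κ = F.wM m * δ κ)
    (hT2 : ∀ m κ, F.db m κ * F.wE m κ = F.wG m * δ' κ) (ha : ∀ κ, aDiag F κ ≠ 0) (hσ : sigma F ≠ 0)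
    (hh : hSum (aDiag F) δ δ' ≠ 0) {α ε ς η : ℝ} (hα : ∀ κ, ‖(aDiag F κ)⁻¹‖ ≤ α) (hε : ∀ κ, ‖δ κ‖ ≤ ε)
    (hς : ‖(sigma F)⁻¹‖ ≤ ς) (hη : ‖(hSum (aDiag F) δ δ')⁻¹‖ ≤ η) (κ : Fin D) (u : Unit) :
    ‖(capMat F)⁻¹ (Sum.inl κ) (Sum.inr u)‖ ≤ α * ε * ς * η := by
  rw [inv_capMat_inl_inr F δ δ' hT1 hT2 ha hσ hh]
  exact CapacitanceClosedForm.norm_invPc_le (aDiag F) δ δ' (sigma F) hα hε hς hη κ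

/-- [folklore] **`cφ` ROW BOUND**: `‖(capMat F)⁻¹ (inr _) (inl l)‖ ≤ αεςη`. -/
theorem norm_inv_capMat_inr_inl_le (δ δ' : Fin D → ℂ) (hT1 : ∀ m κ, F.wQ m κ * F.dd m κ = F.wM m * δ κ)
    (hT2 : ∀ m κ, F.db m κ * F.wE m κ = F.wG m * δ' κ) (ha : ∀ κ, aDiag F κ ≠ 0) (hσ : sigma F ≠ 0)
    (hh : hSum (aDiag F) δ δ' ≠ 0) {α ε ς η : ℝ} (hα : ∀ κ, ‖(aDiag F κ)⁻¹‖ ≤ α) (hε' : ∀ κ, ‖δ' κ‖ ≤ ε)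
    (hς : ‖(sigma F)⁻¹‖ ≤ ς) (hη : ‖(hSum (aDiag F) δ δ')⁻¹‖ ≤ η) (u : Unit) (l : Fin D) :
    ‖(capMat F)⁻¹ (Sum.inr u) (Sum.inl l)‖ ≤ α * ε * ς * η := by
  rw [inv_capMat_inr_inl F δ δ' hT1 hT2 ha hσ hh]
  exact CapacitanceClosedForm.norm_invcP_le (aDiag F) δ δ' (sigma F) hα hε' hς hη l

/-- [folklore] **`cc` CORNER BOUND** (no cancellation): `‖(capMat F)⁻¹ (inr _) (inr _)‖ ≤ ς/2 + ς²η`.  The finer, cancelled form is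
`CapacitanceClosedFormGauge.norm_invcc_le_of_defect` composed with `inv_capMat_inr_inr`. -/
theorem norm_inv_capMat_inr_inr_le (δ δ' : Fin D → ℂ) (hT1 : ∀ m κ, F.wQ m κ * F.dd m κ = F.wM m * δ κ)
    (hT2 : ∀ m κ, F.db m κ * F.wE m κ = F.wG m * δ' κ) (ha : ∀ κ, aDiag F κ ≠ 0) (hσ : sigma F ≠ 0)
    (hh : hSum (aDiag F) δ δ' ≠ 0) {ς η : ℝ} (hς : ‖(sigma F)⁻¹‖ ≤ ς) (hη : ‖(hSum (aDiag F) δ δ')⁻¹‖ ≤ η)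
    (u u' : Unit) :
    ‖(capMat F)⁻¹ (Sum.inr u) (Sum.inr u')‖ ≤ ς / 2 + ς ^ 2 * η := by
  rw [inv_capMat_inr_inr F δ δ' hT1 hT2 ha hσ hh]
  exact CapacitanceClosedForm.norm_invcc_le (aDiag F) δ δ' (sigma F) hς hη

end Fibre

end Summit.QuantumFields.BalabanUV.Beta.GAN24.CapacitanceClosedFormMatrix
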